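import Summits.RiemannHypothesis.RiemannHypothesis.Theorems.WeilBochnerMeasureKernel
import Summits.RiemannHypothesis.RiemannHypothesis.Theorems.SpectralTraceWindowTraceArchStubSelbergTests
import Summits.RiemannHypothesis.RiemannHypothesis.Theorems.WeilGroundStateGroundStatesConvergeToXiEvenWitnessParity
import HarnessLib

/-!
# RiemannHypothesis — counting law of the Bochner–Kreĭn measure: preliminaries

Helper file (`--supports stmt-RiemannHypothesis-0098`), RH-free, standard axioms.  Seat rh-explicit
weil-3 (structure).  Tools for `WeilBochnerMeasureCounting.lean` (the Riemann–von Mangoldt counting law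
`μ[0, T] = θ(T)/π + O(log T)` of every measure `μ` representing Weil's form on a window):

* `weilFunctional_add_of_continuous`: additivity `W(g + h) = W(g) + W(h)` on continuous compactly
  supported kernels with integrable archimedean integrands (used to pass from Selberg's majorant and
  the nonnegative difference `F₊ − F₋` to the minorant, which is not of one sign);
* `represents_map_neg`: if `μ` represents Weil's form on `[-b, b]` so does the reflected measure
  `μ.map (-·)` (`Q(g(-·)) = Q(g)`), and `(μ.map (-·))[0, T] = μ[-T, 0]` (`map_neg_measureReal_Icc`);
* `exists_selberg_kernels`: for `Δ > 0`, `T ≥ 0`, continuous kernels `g±` supported in `[-2πΔ, 2πΔ]`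
  with `ĝ±(½ + zi) = F±(z)`, Selberg's majorant/minorant of `𝟙_{[0,T]}` of bandwidth `Δ`, and
  `g±(0) = T/(2π) ± 1/(2πΔ)` (from `stub_selbergTests_transform` of the crux `WindowTraceArch`);
* `exists_weil_side_bound`: for `2πΔ ≤ log 2` (no prime enters), `|Re W(g±) − θ(T)/π| ≤ A + B log(1+T)`
  with `A, B` independent of `T` (`stub_countingLaw_core`; `θ = riemannSiegelTheta`).
-/

noncomputable section

set_option linter.dupNamespace false  -- the mandated namespace repeats `RiemannHypothesis`

open Complex Filter Set MeasureTheory Asymptotics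
open scoped Real Topology ContDiff ComplexConjugate FourierTransform
open Literature.NumberTheory.LFunctions Literature.Analysis.Fourier Literature.Analysis.SpecialFunctions
open Summit.RiemannHypothesis.RiemannHypothesis.Theorems.SpectralTraceWindowTraceArch

namespace Summit.RiemannHypothesis.RiemannHypothesis.Theorems.WeilBochnerMeasure

variable {b : ℝ} {μ : Measure ℝ}

/-! ## Additivity of `W` on continuous kernels -/

section Additivity

variable {g h : ℝ → ℂ}

/-- `(g + h)` has polar term `P(g) + P(h)` (continuous compactly supported kernels). -/
theorem weilPolarTerm_add (hgc : Continuous g) (hgs : HasCompactSupport g) (hhc : Continuous h)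
    (hhs : HasCompactSupport h) : weilPolarTerm (g + h) = weilPolarTerm g + weilPolarTerm h := by
  unfold weilPolarTerm
  rw [weilMellin_add hgc hgs hhc hhs, weilMellin_add hgc hgs hhc hhs]
  ring

/-- The prime term is additive on compactly supported kernels (finite sums). -/
theorem weilPrimeTerm_add (hgs : HasCompactSupport g) (hhs : HasCompactSupport h) :
    weilPrimeTerm (g + h) = weilPrimeTerm g + weilPrimeTerm h := by
  unfold weilPrimeTerm
  rw [← (summable_weilPrimeTerm hgs).tsum_add (summable_weilPrimeTerm hhs)]
  congr 1 with n
  simp only [Pi.add_apply]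
  ring

/-- The archimedean integral is additive when both archimedean integrands are integrable. -/
theorem weilArchIntegral_add (hgc : Continuous g) (hgs : HasCompactSupport g) (hhc : Continuous h)
    (hhs : HasCompactSupport h)
    (hgA : Integrable fun t : ℝ ↦
      weilMellin g (1 / 2 + t * I) * ((Complex.digamma (1 / 4 + t / 2 * I)).re : ℂ))
    (hhA : Integrable fun t : ℝ ↦
      weilMellin h (1 / 2 + t * I) * ((Complex.digamma (1 / 4 + t / 2 * I)).re : ℂ)) :
    weilArchIntegral (g + h) = weilArchIntegral g + weilArchIntegral h := by
  unfold weilArchIntegral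
  rw [← integral_add hgA hhA]
  refine integral_congr_ae (ae_of_all _ fun t ↦ ?_)
  simp only [weilMellin_add hgc hgs hhc hhs]
  ring

/-- **Additivity of the Weil functional** on continuous compactly supported kernels with integrable
archimedean integrands: `W(g + h) = W(g) + W(h)`. -/
theorem weilFunctional_add_of_continuous (hgc : Continuous g) (hgs : HasCompactSupport g)
    (hhc : Continuous h) (hhs : HasCompactSupport h)
    (hgA : Integrable fun t : ℝ ↦
      weilMellin g (1 / 2 + t * I) * ((Complex.digamma (1 / 4 + t / 2 * I)).re : ℂ))
    (hhA : Integrable fun t : ℝ ↦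
      weilMellin h (1 / 2 + t * I) * ((Complex.digamma (1 / 4 + t / 2 * I)).re : ℂ)) :
    weilFunctional (g + h) = weilFunctional g + weilFunctional h := by
  simp only [weilFunctional, weilArchTerm, weilPolarTerm_add hgc hgs hhc hhs,
    weilPrimeTerm_add hgs hhs, weilArchIntegral_add hgc hgs hhc hhs hgA hhA, Pi.add_apply]
  ring

end Additivity

/-! ## Reflection: the reflected measure represents the same form -/

/-- **Reflection invariance of the class of representing measures.**  If `μ` represents Weil's form on
`[-b, b]`, so does its reflection `μ.map (-·)` (test `g(-·)`: `(g(-·))^(½+it) = ĝ(½-it)` and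
`Q(g(-·)) = Q(g)`). -/
theorem represents_map_neg
    (hμ : ∀ g : ℝ → ℂ, IsWeilTest g → tsupport g ⊆ Icc (-b) b →
      Integrable (fun t : ℝ ↦ ‖weilMellin g (1 / 2 + t * I)‖ ^ 2) μ ∧
        weilQuadratic g = ((∫ t, ‖weilMellin g (1 / 2 + t * I)‖ ^ 2 ∂μ : ℝ) : ℂ)) :
    ∀ g : ℝ → ℂ, IsWeilTest g → tsupport g ⊆ Icc (-b) b →
      Integrable (fun t : ℝ ↦ ‖weilMellin g (1 / 2 + t * I)‖ ^ 2) (μ.map fun t : ℝ ↦ -t) ∧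
        weilQuadratic g =
          ((∫ t, ‖weilMellin g (1 / 2 + t * I)‖ ^ 2 ∂(μ.map fun t : ℝ ↦ -t) : ℝ) : ℂ) := by
  intro g hg hgs
  set gn : ℝ → ℂ := fun t ↦ g (-t) with hgn
  obtain ⟨hi, hQ⟩ := hμ gn hg.comp_neg (GroundStatesConvergeToXi.tsupport_comp_neg_subset_Icc hgs)
  have hline : ∀ t : ℝ, weilMellin gn (1 / 2 + t * I) = weilMellin g (1 / 2 + ((-t : ℝ) : ℂ) * I) := by
    intro t
    rw [hgn, weilMellin_comp_neg]
    congr 1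
    push_cast
    ring
  set Fg : ℝ → ℝ := fun t ↦ ‖weilMellin g (1 / 2 + t * I)‖ ^ 2 with hFg
  have hFgm : AEStronglyMeasurable Fg (μ.map fun t : ℝ ↦ -t) := by
    have h1 : Continuous fun t : ℝ ↦ (1 / 2 : ℂ) + t * I := by fun_prop
    exact (((continuous_weilMellin hg.1.continuous hg.2).comp h1).norm.pow 2).aestronglyMeasurable
  have hcomp : (fun t : ℝ ↦ ‖weilMellin gn (1 / 2 + t * I)‖ ^ 2) = fun t ↦ Fg (-t) := by
    funext t; simp only [hFg, hline t]
  rw [hcomp] at hi hQ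
  have hmeas : AEMeasurable (fun t : ℝ ↦ -t) μ := measurable_neg.aemeasurable
  refine ⟨(integrable_map_measure hFgm hmeas).2 hi, ?_⟩
  rw [hQ.symm.trans (weilQuadratic_comp_neg g) |>.symm, integral_map hmeas hFgm]

/-- The reflected measure of `[0, T]` is `μ[-T, 0]`. -/
theorem map_neg_measureReal_Icc (μ : Measure ℝ) (T : ℝ) :
    (μ.map fun t : ℝ ↦ -t).real (Icc 0 T) = μ.real (Icc (-T) 0) := by
  rw [map_measureReal_apply measurable_neg measurableSet_Icc]
  congr 1
  ext t
  simp only [mem_preimage, mem_Icc]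
  constructor <;> intro h <;> constructor <;> linarith [h.1, h.2]

/-! ## Selberg's band-limited kernels of a general bandwidth -/

/-- **Selberg kernels.**  For `Δ > 0` and `T ≥ 0` there are continuous kernels `g±` supported in
`[-2πΔ, 2πΔ]` whose transforms on `s = ½ + zi` are Selberg's majorant / minorant
`F± = selbergMajorant/Minorant Δ 0 T` of `𝟙_{[0,T]}` (for ALL complex `z`), with
`g±(0) = T/(2π) ± 1/(2πΔ)` (`stub_selbergTests_transform`, `fourier_selbergMajorant_zero`). -/
theorem exists_selberg_kernels {Δ : ℝ} (hΔ : 0 < Δ) {T : ℝ} (hT : 0 ≤ T) :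
    ∃ gp gm : ℝ → ℂ, Continuous gp ∧ Continuous gm ∧
      tsupport gp ⊆ Icc (-(2 * π * Δ)) (2 * π * Δ) ∧ tsupport gm ⊆ Icc (-(2 * π * Δ)) (2 * π * Δ) ∧
      (∀ z : ℂ, weilMellin gp (1 / 2 + z * I) = selbergMajorant Δ 0 T z) ∧
      (∀ z : ℂ, weilMellin gm (1 / 2 + z * I) = selbergMinorant Δ 0 T z) ∧
      gp 0 = ((T / (2 * π) + 1 / (2 * π * Δ) : ℝ) : ℂ) ∧
      gm 0 = ((T / (2 * π) + -(1 / (2 * π * Δ)) : ℝ) : ℂ) := by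
  obtain ⟨gp, hgpc, hgps, hgpM, hgp0⟩ := stub_selbergTests_transform hΔ
    (differentiable_selbergMajorant _ 0 T) (integrable_selbergMajorant_ofReal hΔ hT)
    (fun ξ hξ ↦ fourier_selbergMajorant_eq_zero hΔ hT hξ)
  obtain ⟨gm, hgmc, hgms, hgmM, hgm0⟩ := stub_selbergTests_transform hΔ
    (differentiable_selbergMinorant _ 0 T) (integrable_selbergMinorant_ofReal hΔ hT)
    (fun ξ hξ ↦ fourier_selbergMinorant_eq_zero hΔ hT hξ)
  have hπ : (π : ℝ) ≠ 0 := Real.pi_ne_zero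
  refine ⟨gp, gm, hgpc, hgmc, hgps, hgms, hgpM, hgmM, ?_, ?_⟩
  · rw [hgp0, fourier_selbergMajorant_zero hΔ hT]
    push_cast
    field_simp
    ring
  · rw [hgm0, fourier_selbergMinorant_zero hΔ hT]
    push_cast
    field_simp
    ring

/-- Quadratic decay of a band-limited profile on the real line:
`K ((1+u²)⁻¹ + (1+(u−T)²)⁻¹) ≤ K (1 + 2(1+T²)) / (1+u²)`. -/
theorem profile_le_div {K T u : ℝ} (hK : 0 ≤ K) :
    K * ((1 + (u - 0) ^ 2)⁻¹ + (1 + (u - T) ^ 2)⁻¹) ≤ K * (1 + 2 * (1 + T ^ 2)) / (1 + u ^ 2) := by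
  have key : (1 + (u - T) ^ 2)⁻¹ ≤ 2 * (1 + T ^ 2) / (1 + u ^ 2) := by
    rw [inv_eq_one_div, div_le_div_iff₀ (by positivity) (by positivity)]
    nlinarith [sq_nonneg (u - 2 * T), sq_nonneg (T * (u - T)), sq_nonneg T, sq_nonneg (u - T)]
  rw [sub_zero]
  calc K * ((1 + u ^ 2)⁻¹ + (1 + (u - T) ^ 2)⁻¹)
      ≤ K * ((1 + u ^ 2)⁻¹ + 2 * (1 + T ^ 2) / (1 + u ^ 2)) := by gcongr
    _ = K * (1 + 2 * (1 + T ^ 2)) / (1 + u ^ 2) := by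
        field_simp

/-! ## The Weil side: `|Re W(g±) − θ(T)/π| ≤ A + B log(1+T)` for a general bandwidth -/

/-- **Weil side of the counting law** for Selberg kernels of bandwidth `Δ` with `2πΔ ≤ log 2` (no prime
enters): `|Re W(g±) − θ(T)/π| ≤ A + B log(1 + T)` with `A, B` independent of `T ≥ 0`
(`stub_countingLaw_core`). -/
theorem exists_weil_side_bound {Δ : ℝ} (hΔ0 : 0 < Δ) (hΔ2 : 2 * π * Δ ≤ Real.log 2) :
    ∃ A B : ℝ, ∀ T : ℝ, 0 ≤ T → ∀ g : ℝ → ℂ, Continuous g →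
      tsupport g ⊆ Icc (-(2 * π * Δ)) (2 * π * Δ) →
      ((∀ z : ℂ, weilMellin g (1 / 2 + z * I) = selbergMajorant Δ 0 T z) ∧
          g 0 = ((T / (2 * π) + 1 / (2 * π * Δ) : ℝ) : ℂ) ∨
        (∀ z : ℂ, weilMellin g (1 / 2 + z * I) = selbergMinorant Δ 0 T z) ∧
          g 0 = ((T / (2 * π) + -(1 / (2 * π * Δ)) : ℝ) : ℂ)) →
      |(weilFunctional g).re - riemannSiegelTheta T / π| ≤ A + B * Real.log (1 + T) := by
  have hΔ1 : Δ ≤ 1 := by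
    have h2 : Real.log 2 < 1 := by have := Real.log_two_lt_d9; linarith
    nlinarith [Real.pi_gt_three]
  obtain ⟨w, hw⟩ : ∃ w : ℝ → ℝ, ∀ v, w v = (1 + (Δ * v) ^ 2)⁻¹ := ⟨_, fun v ↦ rfl⟩
  obtain ⟨L, hL⟩ : ∃ L : ℝ → ℝ, ∀ v, L v = 5 + Real.log (1 + |v|) := ⟨_, fun v ↦ rfl⟩
  set P : ℝ := 3 * Real.exp (2 * π) * Real.exp (2 * π * Δ) with hP
  refine ⟨2 * P + |1 / (2 * π * Δ)| * Real.log π + 1 / (2 * π) * (4 * ∫ v, w v * L v),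
    1 / (2 * π) * (2 * ∫ v, w v), ?_⟩
  intro T hT g hg hgs hcase
  have hgs' : tsupport g ⊆ Icc (-Real.log 2) (Real.log 2) :=
    hgs.trans (Icc_subset_Icc (by linarith) hΔ2)
  -- the polar points `s = 0, 1` are `1/2 + zi` with `z = ± i/2`
  have e0 : (1 : ℂ) / 2 + I / 2 * I = 0 := by linear_combination Complex.I_mul_I / 2
  have e1 : (1 : ℂ) / 2 + -I / 2 * I = 1 := by linear_combination -Complex.I_mul_I / 2
  have him0 : |(I / 2 : ℂ).im| ≤ 1 := by norm_num
  have him1 : |(-I / 2 : ℂ).im| ≤ 1 := by norm_num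
  have hexp : ∀ z : ℂ, |z.im| ≤ 1 →
      3 * Real.exp (2 * π) * Real.exp (2 * π * Δ * |z.im|) ≤ P := by
    intro z hz
    rw [hP]
    refine mul_le_mul_of_nonneg_left (Real.exp_le_exp.2 ?_) (by positivity)
    exact mul_le_of_le_one_right (by positivity) hz
  have main : ∀ (Φ : ℂ → ℂ) (Φr : ℝ → ℝ) (e : ℝ),
      (∀ z : ℂ, weilMellin g (1 / 2 + z * I) = Φ z) → (∀ x : ℝ, Φ x = (Φr x : ℂ)) →
      Continuous Φr →
      (∀ z : ℂ, ‖Φ z‖ ≤ 3 * Real.exp (2 * π) * Real.exp (2 * π * Δ * |z.im|)) →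
      (∀ u : ℝ, u ≠ 0 → u ≠ T →
        |Φr u - (Icc 0 T).indicator (fun _ ↦ (1 : ℝ)) u| ≤ 2 * w u + 2 * w (u - T)) →
      g 0 = ((T / (2 * π) + e : ℝ) : ℂ) → |e| = |1 / (2 * π * Δ)| →
      |(weilFunctional g).re - riemannSiegelTheta T / π| ≤
        2 * P + |1 / (2 * π * Δ)| * Real.log π + 1 / (2 * π) * (4 * ∫ v, w v * L v) +
          1 / (2 * π) * (2 * ∫ v, w v) * Real.log (1 + T) := by
    intro Φ Φr e hmel hreal hΦc hnorm hdev hg0 he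
    have hΦ : ∀ u : ℝ, weilMellin g (1 / 2 + u * I) = Φr u := fun u ↦ by rw [hmel, hreal]
    have hP0 : ‖weilMellin g 0‖ ≤ P := by
      rw [← e0, hmel]; exact (hnorm _).trans (hexp _ him0)
    have hP1 : ‖weilMellin g 1‖ ≤ P := by
      rw [← e1, hmel]; exact (hnorm _).trans (hexp _ him1)
    have h := stub_countingLaw_core hΔ0 hΔ1 hT w L hw hL hg hgs' hΦc hΦ hdev hP0 hP1 hg0
    rw [he] at h
    linarith
  rcases hcase with ⟨hmel, hg0⟩ | ⟨hmel, hg0⟩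
  · exact main (selbergMajorant Δ 0 T) (selbergMajorantReal Δ 0 T) (1 / (2 * π * Δ)) hmel
      (selbergMajorant_ofReal Δ 0 T) (continuous_selbergMajorantReal Δ 0 T)
      (norm_selbergMajorant_le hΔ0 0 T)
      (fun u hu0 huT ↦ by rw [hw, hw]; exact stub_countingLaw_majorant_dev hΔ0 hT hu0 huT)
      hg0 rfl
  · exact main (selbergMinorant Δ 0 T) (selbergMinorantReal Δ 0 T) (-(1 / (2 * π * Δ))) hmel
      (selbergMinorant_ofReal Δ 0 T) (continuous_selbergMinorantReal Δ 0 T)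
      (norm_selbergMinorant_le hΔ0 0 T)
      (fun u hu0 huT ↦ by rw [hw, hw]; exact stub_countingLaw_minorant_dev hΔ0 hT hu0 huT)
      hg0 (abs_neg _)

end Summit.RiemannHypothesis.RiemannHypothesis.Theorems.WeilBochnerMeasure

end
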